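import Summits.KontsevichZagierPeriods.KontsevichZagierPeriods.Theorems.HurwitzMicroSectorsNormalFormPrincipleM2FiveZetaTwo

/-!
# `NormalFormPrinciple` (stmt-KontsevichZagierPeriods-3869), line `SketchIdeator1` — leaf `stub_boxRigidity`,
# dimension two off the product type (`CatalanTwoWays`, disc side): the disc-minus block

Registered sub-goal `discMinus_sub_logMonomial` of the layer `CatalanTwoWays` (disc side). Write
`a = √(2 − x²)` (so `1 < a` for `0 < x < 1`). The band-box representation
`Dm = [{0 < x < 1, 0 ≤ y ≤ 1}, 1/(2a(a − y))]` and the unfolded logarithmic monomial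
`Mm = M_x(1/(2a), a/(a − 1)) = [{0 < x < 1, 1 ≤ s ≤ a/(a − 1)}, (1/(2a))/s]` differ by a relation of
the Kontsevich–Zagier calculus (rule 2, twice), through ONE auxiliary band-box representation
`Dr = [{0 < x < 1, 0 ≤ θ ≤ 1}, 1/(2a(a − 1 + θ))]`:

1. the reflection `y = 1 − θ` of the last coordinate (`KZ.boxReflection 1`,
   `KZ.of_sub_of_mem_relations_of_boxReflection`) carries `Dm` to `Dr`; the absolute convergence of
   `Dr` is that of `Dm` transported along the reflection (Jacobian of absolute value `1`,
   `MeasureTheory.integrableOn_image_iff_integrableOn_abs_det_fderiv_smul`), and its integrand is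
   semialgebraic by the closure of semialgebraic functions under `√`, sums, products, quotients;
2. the fibrewise substitution `s = 1 + θ (v(x) − 1)` with `v = a/(a − 1)`, i.e. `v − 1 = 1/(a − 1)`
   (`KZ.of_sub_of_mem_relations_fibreSubst`) carries `Mm` to `Dr`, by the identity
   `(1/(2a)) (v − 1)/(1 + θ (v − 1)) = 1/(2a(a − 1 + θ))`.

References: M. Kontsevich, D. Zagier, *Periods* (2001), §1.2 rule (2). No definitions are
introduced.
-/

noncomputable section

open MeasureTheory Set
open Literature.NumberTheory.Transcendental Literature.NumberTheory.Transcendental.KZ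
open Literature.ModelTheory.ExponentialFields (IsSemialgebraic)

namespace Summit.KontsevichZagierPeriods.HurwitzMicroSectors.NormalFormPrinciple.PiBox.M2

/-- On `0 < x < 1` the radius `a = √(2 − x²)` exceeds `1`. [folklore] -/
theorem discMinus_one_lt_sqrt {x : ℝ} (hx0 : 0 < x) (hx1 : x < 1) : 1 < Real.sqrt (2 - x ^ 2) := by
  rw [Real.lt_sqrt zero_le_one]
  nlinarith

/-- The pull-back identity of the fibrewise substitution `s = 1 + θ (v − 1)`, `v = a/(a − 1)`:
`1/(2a(a − 1 + θ)) = (1/(2a)) (v − 1)/(1 + θ (v − 1))` for `1 < a`, `0 ≤ θ`. [folklore] -/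
theorem discMinus_fibreSubst_identity {a θ : ℝ} (ha : 1 < a) (hθ : 0 ≤ θ) :
    1 / (2 * a * (a - 1 + θ)) = 1 / (2 * a) * (a / (a - 1) - 1) / (1 + θ * (a / (a - 1) - 1)) := by
  have ha0 : a ≠ 0 := by positivity
  have ha1 : a - 1 ≠ 0 := (sub_pos.2 ha).ne'
  have hd : a - 1 + θ ≠ 0 := by
    have : 0 < a - 1 + θ := by linarith
    exact this.ne'
  have e1 : a / (a - 1) - 1 = 1 / (a - 1) := by
    field_simp
    ring
  have e2 : 1 + θ * (1 / (a - 1)) = (a - 1 + θ) / (a - 1) := by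
    field_simp
  rw [e1, e2]
  field_simp

/-- The radius `z ↦ √(2 − z₀²)` is a `ℚ`-semialgebraic function on every `ℚ`-semialgebraic subset of
`ℝⁿ⁺¹` (a polynomial followed by `√`). [folklore] -/
theorem discMinus_isSemialgebraicFunOn_sqrt {n : ℕ} {s : Set (Fin (n + 1) → ℝ)}
    (hs : IsSemialgebraic ℚ s) :
    IsSemialgebraicFunOn ℚ s (fun z => Real.sqrt (2 - z 0 ^ 2)) := by
  have hp : IsSemialgebraicFunOn ℚ s (fun z => 2 - z 0 ^ 2) :=
    (isSemialgebraicFunOn_aeval hs (2 - MvPolynomial.X 0 ^ 2)).congr fun z _ => by simp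
  exact IsSemialgebraicFunOn.sqrt_holds hp

/-- **Stub (disc minus, rule 2 twice).** With `a = √(2 − x²)`: for any representation `Dm` on the
band-box `{0 < x < 1, 0 ≤ y ≤ 1}` with integrand `1/(2a(a − y))` there and any representation `Mm`
on the band `{0 < x < 1, 1 ≤ s ≤ a/(a − 1)}` with integrand `(1/(2a))/s` there (the unfolded
logarithmic monomial `M_x(1/(2a), a/(a − 1))`), `[Dm] − [Mm] ∈ relations`: the reflection
`y = 1 − θ` (`KZ.of_sub_of_mem_relations_of_boxReflection`) lands on the auxiliary
`Dr = [band-box, 1/(2a(a − 1 + θ))]`, and the fibrewise substitution `s = 1 + θ/(a − 1)`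
(`KZ.of_sub_of_mem_relations_fibreSubst` with `v = a/(a − 1)`) carries `Mm` to `Dr`.
[cite: KontsevichZagier2001, §1.2 rule (2)] -/
theorem discMinus_sub_logMonomial (Dm Mm : IntegralRep 2)
    (hDmd : Dm.domain = KZlog.band {y : Fin 1 → ℝ | 0 < y 0 ∧ y 0 < 1} (fun _ => (0:ℝ)) (fun _ => (1:ℝ)))
    (hDmi : EqOn Dm.integrand
      (fun z => 1 / (2 * Real.sqrt (2 - z 0 ^ 2) * (Real.sqrt (2 - z 0 ^ 2) - z 1))) Dm.domain)
    (hMmd : Mm.domain = KZlog.band {y : Fin 1 → ℝ | 0 < y 0 ∧ y 0 < 1} (fun _ => (1:ℝ))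
      (fun y => Real.sqrt (2 - y 0 ^ 2) / (Real.sqrt (2 - y 0 ^ 2) - 1)))
    (hMmi : EqOn Mm.integrand (fun z => (1 / (2 * Real.sqrt (2 - z 0 ^ 2))) / z 1) Mm.domain) :
    of Dm - of Mm ∈ relations := by
  -- the open base `(0,1) ⊆ ℝ¹` and the band-box over it
  have hG : IsSemialgebraic ℚ {y : Fin 1 → ℝ | 0 < y 0 ∧ y 0 < 1} :=
    isSemialgebraic_unitInterval_fin_one
  have hB : IsSemialgebraic ℚ
      (KZlog.band {y : Fin 1 → ℝ | 0 < y 0 ∧ y 0 < 1} (fun _ => (0:ℝ)) (fun _ => (1:ℝ))) :=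
    KZlog.isSemialgebraic_band (by simpa using isSemialgebraicFunOn_ratCast hG 0)
      (by simpa using isSemialgebraicFunOn_ratCast hG 1)
  have hBm : MeasurableSet
      (KZlog.band {y : Fin 1 → ℝ | 0 < y 0 ∧ y 0 < 1} (fun _ => (0:ℝ)) (fun _ => (1:ℝ))) :=
    Literature.ModelTheory.ExponentialFields.IsSemialgebraic.measurableSet_holds hB
  have hBmem : ∀ {z : Fin 2 → ℝ},
      z ∈ KZlog.band {y : Fin 1 → ℝ | 0 < y 0 ∧ y 0 < 1} (fun _ => (0:ℝ)) (fun _ => (1:ℝ)) →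
        (0 < z 0 ∧ z 0 < 1) ∧ 0 ≤ z 1 ∧ z 1 ≤ 1 := fun hz => hz
  -- the reflected kernel `1/(2a(a − 1 + θ))` is semialgebraic on the band-box ...
  have hsqB := discMinus_isSemialgebraicFunOn_sqrt hB
  have hden : IsSemialgebraicFunOn ℚ
      (KZlog.band {y : Fin 1 → ℝ | 0 < y 0 ∧ y 0 < 1} (fun _ => (0:ℝ)) (fun _ => (1:ℝ)))
      (fun z => 2 * Real.sqrt (2 - z 0 ^ 2) * (Real.sqrt (2 - z 0 ^ 2) - 1 + z 1)) :=
    (IsSemialgebraicFunOn.mul_holds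
      (IsSemialgebraicFunOn.mul_holds (by simpa using isSemialgebraicFunOn_ratCast hB 2) hsqB)
      (IsSemialgebraicFunOn.add_holds
        (IsSemialgebraicFunOn.sub_holds hsqB (by simpa using isSemialgebraicFunOn_ratCast hB 1))
        (isSemialgebraicFunOn_apply hB 1))).congr fun z _ => rfl
  have hden0 :
      ∀ z ∈ KZlog.band {y : Fin 1 → ℝ | 0 < y 0 ∧ y 0 < 1} (fun _ => (0:ℝ)) (fun _ => (1:ℝ)),
        2 * Real.sqrt (2 - z 0 ^ 2) * (Real.sqrt (2 - z 0 ^ 2) - 1 + z 1) ≠ 0 := by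
    intro z hz
    have h := hBmem hz
    have ha := discMinus_one_lt_sqrt h.1.1 h.1.2
    have h1 : 0 < Real.sqrt (2 - z 0 ^ 2) - 1 + z 1 := by linarith [h.2.1]
    positivity
  have hsa : IsSemialgebraicFunOn ℚ
      (KZlog.band {y : Fin 1 → ℝ | 0 < y 0 ∧ y 0 < 1} (fun _ => (0:ℝ)) (fun _ => (1:ℝ)))
      (fun z => 1 / (2 * Real.sqrt (2 - z 0 ^ 2) * (Real.sqrt (2 - z 0 ^ 2) - 1 + z 1))) :=
    IsSemialgebraicFunOn.div (by simpa using isSemialgebraicFunOn_ratCast hB 1) hden hden0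
  -- ... and integrable there: transport of the integrability of `Dm` along the reflection
  have hDint : IntegrableOn
      (fun z : Fin 2 → ℝ => 1 / (2 * Real.sqrt (2 - z 0 ^ 2) * (Real.sqrt (2 - z 0 ^ 2) - z 1)))
      (KZlog.band {y : Fin 1 → ℝ | 0 < y 0 ∧ y 0 < 1} (fun _ => (0:ℝ)) (fun _ => (1:ℝ))) := by
    have h := Dm.integrableOn.congr_fun hDmi (IntegralRep.measurableSet_domain_holds Dm)
    rwa [hDmd] at h
  obtain ⟨Lr, hdet, hLr⟩ := exists_hasFDerivAt_boxReflection (1 : Fin 2)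
  have himg : boxReflection 1 ''
        KZlog.band {y : Fin 1 → ℝ | 0 < y 0 ∧ y 0 < 1} (fun _ => (0:ℝ)) (fun _ => (1:ℝ)) =
      KZlog.band {y : Fin 1 → ℝ | 0 < y 0 ∧ y 0 < 1} (fun _ => (0:ℝ)) (fun _ => (1:ℝ)) := by
    conv_lhs => rw [← zetaBand_preimage_boxReflection]
    exact image_preimage_eq _ (boxReflection_involutive 1).surjective
  have hint : IntegrableOn
      (fun z : Fin 2 → ℝ => 1 / (2 * Real.sqrt (2 - z 0 ^ 2) * (Real.sqrt (2 - z 0 ^ 2) - 1 + z 1)))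
      (KZlog.band {y : Fin 1 → ℝ | 0 < y 0 ∧ y 0 < 1} (fun _ => (0:ℝ)) (fun _ => (1:ℝ))) := by
    have key := (integrableOn_image_iff_integrableOn_abs_det_fderiv_smul volume hBm
      (f' := fun _ => Lr) (fun x _ => (hLr x).hasFDerivWithinAt)
      (boxReflection_involutive 1).injective.injOn
      (fun z : Fin 2 → ℝ =>
        1 / (2 * Real.sqrt (2 - z 0 ^ 2) * (Real.sqrt (2 - z 0 ^ 2) - z 1)))).1
      (by rw [himg]; exact hDint)
    refine key.congr_fun (fun x _ => ?_) hBm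
    simp only [hdet, one_smul, boxReflection_apply_self,
      boxReflection_apply_of_ne (show (0 : Fin 2) ≠ 1 by decide)]
    ring
  -- the auxiliary representation `Dr = [band-box, 1/(2a(a − 1 + θ))]`
  obtain ⟨Dr, hrd, hri⟩ : ∃ Dr : IntegralRep 2,
      Dr.domain = KZlog.band {y : Fin 1 → ℝ | 0 < y 0 ∧ y 0 < 1} (fun _ => (0:ℝ)) (fun _ => (1:ℝ)) ∧
      Dr.integrand = fun z =>
        1 / (2 * Real.sqrt (2 - z 0 ^ 2) * (Real.sqrt (2 - z 0 ^ 2) - 1 + z 1)) :=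
    ⟨⟨_, _, hB, hsa, hint⟩, rfl, rfl⟩
  -- (rule 2, reflection `y = 1 − θ`) `Dm` versus `Dr`
  have e1 : of Dm - of Dr ∈ relations := by
    refine of_sub_of_mem_relations_of_boxReflection (1 : Fin 2) ?_ fun x hx => ?_
    · rw [hDmd, hrd, zetaBand_preimage_boxReflection]
    · rw [hDmi hx, hri]
      simp only [boxReflection_apply_self,
        boxReflection_apply_of_ne (show (0 : Fin 2) ≠ 1 by decide)]
      ring
  -- (rule 2, fibrewise substitution `s = 1 + θ (v − 1)`, `v = a/(a − 1)`) `Mm` versus `Dr`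
  have hv : IsSemialgebraicFunOn ℚ {y : Fin 1 → ℝ | 0 < y 0 ∧ y 0 < 1}
      (fun y => Real.sqrt (2 - y 0 ^ 2) / (Real.sqrt (2 - y 0 ^ 2) - 1)) := by
    have hsq := discMinus_isSemialgebraicFunOn_sqrt hG
    refine IsSemialgebraicFunOn.div hsq
      ((IsSemialgebraicFunOn.sub_holds hsq (by simpa using isSemialgebraicFunOn_ratCast hG 1)).congr
        fun y _ => rfl) fun y hy => ?_
    have h : 0 < y 0 ∧ y 0 < 1 := hy
    exact (sub_pos.2 (discMinus_one_lt_sqrt h.1 h.2)).ne'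
  have hv1 : ∀ y ∈ {y : Fin 1 → ℝ | 0 < y 0 ∧ y 0 < 1},
      (1:ℝ) ≤ Real.sqrt (2 - y 0 ^ 2) / (Real.sqrt (2 - y 0 ^ 2) - 1) := by
    intro y hy
    have h : 0 < y 0 ∧ y 0 < 1 := hy
    have ha := discMinus_one_lt_sqrt h.1 h.2
    exact (one_le_div (sub_pos.2 ha)).2 (by linarith)
  have e2 : of Mm - of Dr ∈ relations := by
    refine of_sub_of_mem_relations_fibreSubst (m := 1)
      (f := fun y => 1 / (2 * Real.sqrt (2 - y 0 ^ 2)))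
      (v := fun y => Real.sqrt (2 - y 0 ^ 2) / (Real.sqrt (2 - y 0 ^ 2) - 1)) hG hv hv1 Mm Dr hMmd
      (fun z hz => hMmi hz) hrd fun z hz => ?_
    rw [hrd] at hz
    have h := hBmem hz
    rw [hri]
    show 1 / (2 * Real.sqrt (2 - z 0 ^ 2) * (Real.sqrt (2 - z 0 ^ 2) - 1 + z 1)) =
      1 / (2 * Real.sqrt (2 - z 0 ^ 2)) *
        (Real.sqrt (2 - z 0 ^ 2) / (Real.sqrt (2 - z 0 ^ 2) - 1) - 1) /
        (1 + z 1 * (Real.sqrt (2 - z 0 ^ 2) / (Real.sqrt (2 - z 0 ^ 2) - 1) - 1))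
    exact discMinus_fibreSubst_identity (discMinus_one_lt_sqrt h.1.1 h.1.2) h.2.1
  -- bookkeeping
  have e : of Dm - of Mm = (of Dm - of Dr) - (of Mm - of Dr) := by abel
  rw [e]
  exact relations.sub_mem e1 e2

end Summit.KontsevichZagierPeriods.HurwitzMicroSectors.NormalFormPrinciple.PiBox.M2
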